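import Summits.CriticalPhenomena.Ising3DConformalLimit.Theorems.LeeYangGapNearCriticalLeeYangGapFirstZeroRateAnatomy
import Literature.Probability.LatticeModels.LeeYangFirstZeroLimitProofs
import Literature.Probability.LatticeModels.UrsellFirstZeroFromCurrents

/-!
# Near-critical Lee–Yang gap — what the open stub S1r `stub_firstZeroRate` IS

Route `LeeYangGap` (Ising3DConformalLimit), crux `NearCriticalLeeYangGap` (GAP, item
stmt-CriticalPhenomena-4945), line `registered`, lead c6. The held open stub is the FIRST-ZERO RATE

  (S1r)  `∃ A K₀ β₀, ∀ β ∈ [β₀,β_c), ∀ L ≥ K₀ξ(β), ∀ n, α₁(Λ_L,β) ≤ A·α₁(Λ_n,β)`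

(`α₁(Λ,β) = JiangNewman.firstZero 3 Λ β`, the first Lee–Yang zero of the FREE cube; `ξ = isingCorrLength 3`,
`χ = susceptibility 3`). Lead c5 landed its anatomy (`…FirstZeroRateAnatomy.lean`): S1r ⟹ (I) and
EDGE + S1r ⟹ (II), where

  (I)   `∃ c > 0, β₁ < β_c, ∀ β ∈ [β₁,β_c), ∀ n, c ≤ α₁(Λ_n,β)²·χ(β)·ξ(β)³`
        — reverse edge hyperscaling, uniformly in the cube (`θ_e²χξ³ ≥ c` in Jiang–Newman's limit);
  (II)  `∃ C K₀, β₀ < β_c, ∀ β ∈ [β₀,β_c), ∀ L ≥ K₀ξ(β), α₁(Λ_L,β)²·χ(β)·ξ(β)³ ≤ C`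
        — edge hyperscaling read on every cube of at least `K₀` correlation lengths (the route's crux EDGE,
        item 4946, transported to cubes).

This file closes the circle, kernel-checked:

* `firstZeroRate_of_reverseEdge_of_cubeEdge` — **(I) ∧ (II) ⟹ S1r** (pure algebra: `α₁(Λ_L)² ≤ C/(χξ³)`
  and `α₁(Λ_n)² ≥ c/(χξ³)` give `α₁(Λ_L) ≤ √(C/c)·α₁(Λ_n)`; the positivity `χξ³ > 0` is read off (I));
* `firstZeroRate_iff_of_edge` — **under EDGE, S1r ⟺ (I) ∧ (II)**: the finite-size-scaling stub held by
  leads c3–c6 is EXACTLY two-sided edge hyperscaling `α₁(Λ_L,β)² ≍ (χξ³)⁻¹` for all free cubes beyond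
  `K₀` correlation lengths, uniformly as `β ↑ β_c` — in particular never weaker than the amplitude relation
  `θ_e(β)² ≍ (χ(β)ξ(β)³)⁻¹` (`2Δ = γ + 3ν`), of which the route's crux EDGE is one half;
* `stub_firstZeroRateOfCubeEdgeScaling` — the registered (curried) form of the first item;
* `firstZeroRate_iff_diagonal` — S1r is a ONE-SCALE statement: by Camia–Jiang–Newman antitonicity of
  `n ↦ α₁(Λ_n,β)` (tree theorem `JiangNewman.antitone_firstZero_of_CJN` with the proved
  `CamiaJiangNewman2023_thm2_holds`) it is equivalent to its instance at the single cube `L = ⌈K₀ξ(β)⌉₊`.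

No new definitions, no named facts, no `sorry`; serves item stmt-CriticalPhenomena-4945 (`--supports`).

## References

* C. M. Newman, CMP 41 (1975) 1–9 [Newman1975]; J. Jiang, C. M. Newman, CPAM 77 (2024) [JiangNewman2023];
  F. Camia, J. Jiang, C. M. Newman, arXiv:2207.12247, Thm 2 / Cor 1 [CamiaJiangNewman2023];
  C. Itzykson, R. B. Pearson, J. B. Zuber, Nucl. Phys. B220 (1983) 415–433 [ItzyksonPearsonZuber1983].
-/

noncomputable section

namespace Summit.CriticalPhenomena.Ising3DConformalLimit.LeeYangGapNearCriticalLeeYangGap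

open Filter Finset
open Literature.Probability.LatticeModels
open Summit.CriticalPhenomena.Ising3DConformalLimit.Theses.LeeYangGap (YangLeeEdgeHyperscaling)

/-! ### (I) ∧ (II) ⟹ S1r -/

/-- **Reverse edge hyperscaling on cubes (I) and edge hyperscaling on cubes beyond `K₀ξ` (II) imply the
first-zero rate S1r**, with `A = √(C/c) + 1`: for `β` in the common window, `L ≥ K₀ξ(β)` and any `n`,
`α₁(Λ_L,β)²·χξ³ ≤ C` and `c ≤ α₁(Λ_n,β)²·χξ³` give `α₁(Λ_L,β)² ≤ (C/c)·α₁(Λ_n,β)²` (the factor `χξ³` is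
positive because `0 < c ≤ α₁²·χ·ξ³` with `α₁², χ ≥ 0`). -/
theorem firstZeroRate_of_reverseEdge_of_cubeEdge
    (hI : ∃ c β₁ : ℝ, 0 < c ∧ β₁ < criticalBeta 3 ∧ ∀ β : ℝ, β₁ ≤ β → β < criticalBeta 3 → ∀ n : ℕ,
      c ≤ JiangNewman.firstZero 3 (box 3 n) β ^ 2 * (susceptibility 3 β).toReal *
        isingCorrLength 3 β ^ 3)
    (hII : ∃ C K₀ β₀ : ℝ, 0 < K₀ ∧ β₀ < criticalBeta 3 ∧ ∀ β : ℝ, β₀ ≤ β → β < criticalBeta 3 →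
      ∀ L : ℕ, K₀ * isingCorrLength 3 β ≤ (L : ℝ) →
        JiangNewman.firstZero 3 (box 3 L) β ^ 2 * (susceptibility 3 β).toReal *
          isingCorrLength 3 β ^ 3 ≤ C) :
    ∃ A K₀ β₀ : ℝ, 0 < A ∧ 0 < K₀ ∧ β₀ < Literature.Probability.LatticeModels.criticalBeta 3 ∧
      ∀ β : ℝ, β₀ ≤ β → β < Literature.Probability.LatticeModels.criticalBeta 3 → ∀ L : ℕ,
        K₀ * Literature.Probability.LatticeModels.isingCorrLength 3 β ≤ (L : ℝ) → ∀ n : ℕ,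
          Literature.Probability.LatticeModels.JiangNewman.firstZero 3
              (Literature.Probability.LatticeModels.box 3 L) β ≤
            A * Literature.Probability.LatticeModels.JiangNewman.firstZero 3
              (Literature.Probability.LatticeModels.box 3 n) β := by
  obtain ⟨c, β₁, hc, hβ₁, hI⟩ := hI
  obtain ⟨C, K₀, β₀, hK₀, hβ₀, hII⟩ := hII
  refine ⟨Real.sqrt (C / c) + 1, K₀, max β₀ β₁, by positivity, hK₀, max_lt hβ₀ hβ₁,
    fun β hβ hββc L hL n => ?_⟩
  have hβ₀β : β₀ ≤ β := (le_max_left _ _).trans hβ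
  have hβ₁β : β₁ ≤ β := (le_max_right _ _).trans hβ
  set αL := JiangNewman.firstZero 3 (box 3 L) β with hαL
  set αn := JiangNewman.firstZero 3 (box 3 n) β with hαn
  set P := (susceptibility 3 β).toReal * isingCorrLength 3 β ^ 3 with hP
  have hαL0 : 0 ≤ αL := JiangNewman.firstZero_nonneg 3 (box 3 L) β
  have hαn0 : 0 ≤ αn := JiangNewman.firstZero_nonneg 3 (box 3 n) β
  have hlow : c ≤ αn ^ 2 * P := by
    have := hI β hβ₁β hββc n; rw [hP, ← mul_assoc]; exact this
  have hup : αL ^ 2 * P ≤ C := by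
    have := hII β hβ₀β hββc L hL; rw [hP, ← mul_assoc]; exact this
  -- positivity of `P = χξ³`, read off (I)
  have hχ0 : 0 ≤ (susceptibility 3 β).toReal := ENNReal.toReal_nonneg
  have hP0 : 0 < P := by
    have hprod : 0 < αn ^ 2 * P := hc.trans_le hlow
    rcases lt_or_ge 0 P with h | h
    · exact h
    · exact absurd hprod (not_lt.2 (mul_nonpos_of_nonneg_of_nonpos (sq_nonneg _) h))
  have hC0 : 0 ≤ C := le_trans (mul_nonneg (sq_nonneg _) hP0.le) hup
  -- `αL² ≤ (C/c)·αn²`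
  have hsq : αL ^ 2 ≤ C / c * αn ^ 2 := by
    rw [div_mul_eq_mul_div, le_div_iff₀ hc]
    -- `αL²·c ≤ αL²·(αn²P)·?` : multiply `hup` by `αn²` and `hlow` by `αL²`
    have h1 : αL ^ 2 * c ≤ αL ^ 2 * (αn ^ 2 * P) := mul_le_mul_of_nonneg_left hlow (sq_nonneg _)
    have h2 : αn ^ 2 * (αL ^ 2 * P) ≤ αn ^ 2 * C := mul_le_mul_of_nonneg_left hup (sq_nonneg _)
    nlinarith [h1, h2]
  have hsqrt : αL ≤ Real.sqrt (C / c) * αn := by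
    have h := Real.sqrt_le_sqrt hsq
    rwa [Real.sqrt_sq hαL0, Real.sqrt_mul (div_nonneg hC0 hc.le), Real.sqrt_sq hαn0] at h
  calc αL ≤ Real.sqrt (C / c) * αn := hsqrt
    _ ≤ (Real.sqrt (C / c) + 1) * αn := by nlinarith [Real.sqrt_nonneg (C / c)]

/-! ### Under EDGE: S1r ⟺ (I) ∧ (II) -/

/-- **Characterisation of the first-zero rate under EDGE.** Given the route's crux EDGE (item 4946,
`YangLeeEdgeHyperscaling`, by name), the registered open stub S1r `stub_firstZeroRate` holds if and only
if BOTH edge-hyperscaling bounds hold on free cubes: (I) `c ≤ α₁(Λ_n,β)²χξ³` for every cube and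
(II) `α₁(Λ_L,β)²χξ³ ≤ C` for every cube with `L ≥ K₀ξ(β)`, uniformly as `β ↑ β_c`
(⟹: lead c5's `reverseEdge_of_firstZeroRate` and `cubeZero_sq_mul_le_of_edge_of_firstZeroRate`;
⟸: `firstZeroRate_of_reverseEdge_of_cubeEdge`, which does not use EDGE). So, inside the line, S1r is not a
finite-size lemma sitting below the thermodynamic crux EDGE: it is two-sided edge hyperscaling
`α₁(Λ_L,β)² ≍ (χξ³)⁻¹` on all cubes from `K₀` correlation lengths on. -/
theorem firstZeroRate_iff_of_edge (hE : YangLeeEdgeHyperscaling) :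
    (∃ A K₀ β₀ : ℝ, 0 < A ∧ 0 < K₀ ∧ β₀ < Literature.Probability.LatticeModels.criticalBeta 3 ∧
      ∀ β : ℝ, β₀ ≤ β → β < Literature.Probability.LatticeModels.criticalBeta 3 → ∀ L : ℕ,
        K₀ * Literature.Probability.LatticeModels.isingCorrLength 3 β ≤ (L : ℝ) → ∀ n : ℕ,
          Literature.Probability.LatticeModels.JiangNewman.firstZero 3
              (Literature.Probability.LatticeModels.box 3 L) β ≤
            A * Literature.Probability.LatticeModels.JiangNewman.firstZero 3
              (Literature.Probability.LatticeModels.box 3 n) β) ↔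
    ((∃ c β₁ : ℝ, 0 < c ∧ β₁ < criticalBeta 3 ∧ ∀ β : ℝ, β₁ ≤ β → β < criticalBeta 3 → ∀ n : ℕ,
        c ≤ JiangNewman.firstZero 3 (box 3 n) β ^ 2 * (susceptibility 3 β).toReal *
          isingCorrLength 3 β ^ 3) ∧
      (∃ C K₀ β₀ : ℝ, 0 < K₀ ∧ β₀ < criticalBeta 3 ∧ ∀ β : ℝ, β₀ ≤ β → β < criticalBeta 3 →
        ∀ L : ℕ, K₀ * isingCorrLength 3 β ≤ (L : ℝ) →
          JiangNewman.firstZero 3 (box 3 L) β ^ 2 * (susceptibility 3 β).toReal *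
            isingCorrLength 3 β ^ 3 ≤ C)) :=
  ⟨fun hR => ⟨reverseEdge_of_firstZeroRate hR, cubeZero_sq_mul_le_of_edge_of_firstZeroRate hE hR⟩,
    fun h => firstZeroRate_of_reverseEdge_of_cubeEdge h.1 h.2⟩

/-! ### S1r is a one-scale statement -/

/-- Antitonicity of the free cube's first Lee–Yang zero in the cube, `α₁(Λ_m,β) ≤ α₁(Λ_n,β)` for
`n ≤ m`, `0 ≤ β` (Camia–Jiang–Newman 2023 Cor 1; tree: `JiangNewman.antitone_firstZero_of_CJN` with the
proved named fact `CamiaJiangNewman2023_thm2_holds`). -/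
theorem firstZero_box_antitone_volume {β : ℝ} (hβ : 0 ≤ β) {n m : ℕ} (hnm : n ≤ m) :
    JiangNewman.firstZero 3 (box 3 m) β ≤ JiangNewman.firstZero 3 (box 3 n) β :=
  JiangNewman.antitone_firstZero_of_CJN (d := 3) CamiaJiangNewman2023_thm2_holds hβ hnm

/-- **S1r ⟺ its diagonal instance.** The first-zero rate for all cubes `L ≥ K₀ξ(β)` is equivalent to
the rate at the single cube `L = ⌈K₀ξ(β)⌉₊` (same constants), because `L ↦ α₁(Λ_L,β)` is non-increasing
(`firstZero_box_antitone_volume`; `β ≥ 0` is arranged by raising the threshold to `max β₀ 0`, harmless as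
`β_c(3) > 0`). -/
theorem firstZeroRate_iff_diagonal :
    (∃ A K₀ β₀ : ℝ, 0 < A ∧ 0 < K₀ ∧ β₀ < Literature.Probability.LatticeModels.criticalBeta 3 ∧
      ∀ β : ℝ, β₀ ≤ β → β < Literature.Probability.LatticeModels.criticalBeta 3 → ∀ L : ℕ,
        K₀ * Literature.Probability.LatticeModels.isingCorrLength 3 β ≤ (L : ℝ) → ∀ n : ℕ,
          Literature.Probability.LatticeModels.JiangNewman.firstZero 3
              (Literature.Probability.LatticeModels.box 3 L) β ≤
            A * Literature.Probability.LatticeModels.JiangNewman.firstZero 3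
              (Literature.Probability.LatticeModels.box 3 n) β) ↔
    (∃ A K₀ β₀ : ℝ, 0 < A ∧ 0 < K₀ ∧ β₀ < criticalBeta 3 ∧
      ∀ β : ℝ, β₀ ≤ β → β < criticalBeta 3 → ∀ n : ℕ,
        JiangNewman.firstZero 3 (box 3 ⌈K₀ * isingCorrLength 3 β⌉₊) β ≤
          A * JiangNewman.firstZero 3 (box 3 n) β) := by
  constructor
  · rintro ⟨A, K₀, β₀, hA, hK₀, hβ₀, h⟩
    exact ⟨A, K₀, β₀, hA, hK₀, hβ₀, fun β hβ hββc n => h β hβ hββc _ (Nat.le_ceil _) n⟩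
  · rintro ⟨A, K₀, β₀, hA, hK₀, hβ₀, h⟩
    have hβc : 0 < criticalBeta 3 := criticalBeta_pos_holds (d := 3) (by norm_num)
    refine ⟨A, K₀, max β₀ 0, hA, hK₀, max_lt hβ₀ hβc, fun β hβ hββc L hL n => ?_⟩
    have hβ₀β : β₀ ≤ β := (le_max_left _ _).trans hβ
    have hβ0 : 0 ≤ β := (le_max_right _ _).trans hβ
    have hceil : ⌈K₀ * isingCorrLength 3 β⌉₊ ≤ L := Nat.ceil_le.2 hL
    exact (firstZero_box_antitone_volume hβ0 hceil).trans (h β hβ₀β hββc n)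

/-! ### Registered form -/

/-- **`stub_firstZeroRateOfCubeEdgeScaling` — (I) ⟹ (II) ⟹ S1r** (registered anatomy/glue stub of line
`registered`, verbatim; it is `firstZeroRate_of_reverseEdge_of_cubeEdge` curried): reverse edge hyperscaling
on cubes and edge hyperscaling on cubes beyond `K₀ξ` imply the registered open stub `stub_firstZeroRate`. -/
theorem stub_firstZeroRateOfCubeEdgeScaling :
    (∃ c β₁ : ℝ, 0 < c ∧ β₁ < Literature.Probability.LatticeModels.criticalBeta 3 ∧ ∀ β : ℝ, β₁ ≤ β → β < Literature.Probability.LatticeModels.criticalBeta 3 → ∀ n : ℕ, c ≤ Literature.Probability.LatticeModels.JiangNewman.firstZero 3 (Literature.Probability.LatticeModels.box 3 n) β ^ 2 * (Literature.Probability.LatticeModels.susceptibility 3 β).toReal * Literature.Probability.LatticeModels.isingCorrLength 3 β ^ 3) → (∃ C K₀ β₀ : ℝ, 0 < K₀ ∧ β₀ < Literature.Probability.LatticeModels.criticalBeta 3 ∧ ∀ β : ℝ, β₀ ≤ β → β < Literature.Probability.LatticeModels.criticalBeta 3 → ∀ L : ℕ, K₀ * Literature.Probability.LatticeModels.isingCorrLength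 3 β ≤ (L : ℝ) → Literature.Probability.LatticeModels.JiangNewman.firstZero 3 (Literature.Probability.LatticeModels.box 3 L) β ^ 2 * (Literature.Probability.LatticeModels.susceptibility 3 β).toReal * Literature.Probability.LatticeModels.isingCorrLength 3 β ^ 3 ≤ C) → ∃ A K₀ β₀ : ℝ, 0 < A ∧ 0 < K₀ ∧ β₀ < Literature.Probability.LatticeModels.criticalBeta 3 ∧ ∀ β : ℝ, β₀ ≤ β → β < Literature.Probability.LatticeModels.criticalBeta 3 → ∀ L : ℕ, K₀ * Literature.Probability.LatticeModels.isingCorrLength 3 β ≤ (L : ℝ) → ∀ n : ℕ, Literature.Probability.LatticeModels.JiangNewman.firstZero 3 (Literature.Probability.LatticeModels.box 3 L) β ≤ A * Literature.Probability.LatticeModels.JiangNewman.firstZero 3 (Literature.Probability.LatticeModels.box 3 n) β :=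
  fun hI hII => firstZeroRate_of_reverseEdge_of_cubeEdge hI hII

end Summit.CriticalPhenomena.Ising3DConformalLimit.LeeYangGapNearCriticalLeeYangGap

end
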